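import Summits.CriticalPhenomena.Ising3DConformalLimit.Theorems.HarmonicMomentsIsotropyHarmonicDilutionGaussianRungMoments
import Summits.CriticalPhenomena.Ising3DConformalLimit.Theorems.HarmonicMomentsIsotropyHarmonicDilutionSymmetric
import HarnessLib

/-!
# Route HarmonicMomentsIsotropy — the Gaussian rung of `HarmonicDilution`

Support file for item `stmt-CriticalPhenomena-6034` (`HarmonicDilution`), concluding the series
`…GaussianRung{Filtration,Symbol,Moments}`.

`HarmonicDilution` asks, for the subcritical Ising two-point function `G_β = ⟨σ₀σₓ⟩^∅_β` on `ℤ³`,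
that every anisotropy ratio `a_{Y,m}(β) = ∑ₓ Y(x)|x|^{2m}G_β(x) / ∑ₓ |x|^{n+2m}G_β(x)` (`Y` harmonic
homogeneous of degree `n ≥ 1`) tends to `0` as `β ↑ β_c` — the Campostrini–Pelissetto–Rossi–Vicari
prediction `ρ > 0`, open.  The route's thesis rests on the claim that the same statement, and the
angular hierarchy behind it, are THEOREMS on every "convolution rung" (lattice Gaussian field,
killed simple random walk; CampostriniEtAl1998 §4.2: `ρ = 2` exactly for the Gaussian model).  This
file proves that claim for the milestone itself, in the item's exact shape with the Ising two-point
function replaced by the simple-random-walk Green function `C_t = srwGreen 3 t = ∑ₙ tⁿ D^{⋆n}`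
(`= (6/t)·` massive lattice propagator of mass `m² = 6(1-t)/t`; criticality is `t ↑ 1`):

* `srwGreen_harmonicDilution` — for every harmonic homogeneous `Y` of degree `n ≥ 1` and every
  `m`, `∑ₓ Y(x)|x|^{2m}C_t(x) / ∑ₓ |x|^{n+2m}C_t(x) → 0` as `t ↑ 1`.

Proof: odd `n` — the numerator vanishes identically (`x ↦ -x`); even `n = 2n'`, `p = n' + m` — by
the Green pairing (`tsum_eval_mul_srwGreen`) numerator and denominator are
`∑_{k ≤ p} c_k t^k/(1-t)^{k+1}` with top coefficients `c_p = 6^{-p}(N^p(|x|^{2m}Y))(0) = 0`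
(harmonic weights are unsourced, `eval_zero_dlap_iterate_rsq_pow_mul_eq_zero`) resp.
`6^{-p} γ_p > 0` (`dlap_iterate_rsq_pow_self`); after multiplying through by `(1-t)^{p+1}` the
ratio is a quotient of polynomials in `t` with values `0 / (6^{-p}γ_p)` at `t = 1`.  In particular
`a_{Y,m}(t) = O(1 - t) = O(m²)`, i.e. `ρ = 2` — e.g. `a_{K₄,0}(t) = (2/5)(1-t)/(1+(7/3)t)`.
-/

noncomputable section

open MvPolynomial Finset Filter Topology
open Literature.Probability.LatticeModels (Site)
open Literature.Barriers.CriticalPhenomena (srwGreen srwGreen_neg)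

namespace Summit.CriticalPhenomena.Ising3DConformalLimit.Theorems.HarmonicMomentsIsotropy.GaussianRung

open Summit.CriticalPhenomena.Ising3DConformalLimit.Theorems (eval_smul_of_isHomogeneous)
open Summit.CriticalPhenomena.Ising3DConformalLimit.Theorems.HarmonicMomentsIsotropy (siteW siteW_apply)
open Summit.CriticalPhenomena.Ising3DConformalLimit.Theorems.HarmonicMomentsIsotropy.Fischer
  (Poly rsq lap lap_apply rsq_isHomogeneous)

/-! ## The weights of the item are polynomial evaluations -/

/-- `|x|^{2m} = (|x|²)^m` evaluated: `√(∑ xᵢ²)^{2m} = (rsq^m)(ι x)`. -/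
theorem sqrt_pow_two_mul_eq_eval (x : Site 3) (m : ℕ) :
    Real.sqrt (∑ i, ((x i : ℝ)) ^ 2) ^ (2 * m) = eval (siteW x) (rsq ^ m) := by
  rw [pow_mul, Real.sq_sqrt (Finset.sum_nonneg fun i _ => sq_nonneg _), map_pow]
  congr 1
  simp only [rsq, map_sum, map_pow, eval_X, siteW_apply]

/-- The coordinate embedding of the item is `siteW`. -/
theorem coe_eq_siteW (x : Site 3) : (fun i => (x i : ℝ)) = siteW x := rfl

/-! ## Laurent sums in `1 - t` -/

/-- Clearing denominators: `∑_{k≤p} c_k t^k/(1-t)^{k+1} = (∑_{k≤p} c_k t^k (1-t)^{p-k}) / (1-t)^{p+1}`. -/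
theorem laurent_sum_eq_div (c : ℕ → ℝ) (p : ℕ) {t : ℝ} (ht : t < 1) :
    ∑ k ∈ range (p + 1), c k * (t ^ k / (1 - t) ^ (k + 1)) =
      (∑ k ∈ range (p + 1), c k * (t ^ k * (1 - t) ^ (p - k))) / (1 - t) ^ (p + 1) := by
  have h1 : (1 - t) ≠ 0 := (sub_pos.2 ht).ne'
  rw [Finset.sum_div]
  refine Finset.sum_congr rfl fun k hk => ?_
  have hkp : k ≤ p := Nat.lt_succ_iff.mp (mem_range.mp hk)
  rw [mul_div_assoc]
  congr 1
  rw [div_eq_div_iff (pow_ne_zero _ h1) (pow_ne_zero _ h1), mul_assoc, ← pow_add]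
  congr 2
  omega

/-- The cleared numerator/denominator `∑_{k≤p} c_k t^k (1-t)^{p-k}` is continuous in `t`. -/
theorem continuous_cleared (c : ℕ → ℝ) (p : ℕ) :
    Continuous fun t : ℝ => ∑ k ∈ range (p + 1), c k * (t ^ k * (1 - t) ^ (p - k)) :=
  continuous_finsetSum _ fun k _ => by fun_prop

/-- … and its value at `t = 1` is the top coefficient `c_p`. -/
theorem cleared_one (c : ℕ → ℝ) (p : ℕ) :
    ∑ k ∈ range (p + 1), c k * ((1 : ℝ) ^ k * (1 - 1) ^ (p - k)) = c p := by
  rw [Finset.sum_eq_single p (fun k hk hkp => ?_) (fun h => absurd (mem_range.2 (Nat.lt_succ_self p)) h)]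
  · rw [one_pow, Nat.sub_self, pow_zero, mul_one, mul_one]
  · have : p - k ≠ 0 := by
      have := mem_range.1 hk
      omega
    rw [sub_self, zero_pow this, mul_zero, mul_zero]

/-! ## The numerator vanishes for odd degree -/

/-- For `Y` homogeneous of odd degree the lattice sum `∑ₓ Y(x)|x|^{2m}C_t(x)` vanishes (`x ↦ -x`). -/
theorem tsum_odd_eq_zero {Y : Poly} {n : ℕ} (hY : Y.IsHomogeneous n) (hn : Odd n) (m : ℕ) (t : ℝ) :
    ∑' x : Site 3, eval (siteW x) Y * Real.sqrt (∑ i, ((x i : ℝ)) ^ 2) ^ (2 * m) * srwGreen 3 t x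
      = 0 := by
  set f : Site 3 → ℝ := fun x =>
    eval (siteW x) Y * Real.sqrt (∑ i, ((x i : ℝ)) ^ 2) ^ (2 * m) * srwGreen 3 t x with hf
  have hneg : ∀ x, f (-x) = -f x := by
    intro x
    have hY' : eval (siteW (-x)) Y = -eval (siteW x) Y := by
      have e : siteW (-x) = fun i => (-1 : ℝ) * siteW x i := by
        funext i; simp only [siteW_apply, Pi.neg_apply, Int.cast_neg, neg_one_mul]
      rw [e, eval_smul_of_isHomogeneous Y hY, hn.neg_one_pow, neg_one_mul]
    have hsq : (∑ i, (((-x) i : ℤ) : ℝ) ^ 2) = ∑ i, ((x i : ℝ)) ^ 2 := by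
      refine Finset.sum_congr rfl fun i _ => ?_
      rw [Pi.neg_apply, Int.cast_neg, neg_sq]
    simp only [hf, hY', hsq, srwGreen_neg]
    ring
  have h : ∑' x, f x = -∑' x, f x := by
    conv_lhs => rw [← (Equiv.neg (Site 3)).tsum_eq f]
    simp only [Equiv.neg_apply, hneg, tsum_neg]
  show ∑' x, f x = 0
  linarith

/-! ## Even degree: the Laurent representation -/

/-- Factoring out the vanishing top order: if `c_p = 0` then
`∑_{k≤p} c_k t^k (1-t)^{p-k} = (1-t) ∑_{k<p} c_k t^k (1-t)^{p-1-k}`. -/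
theorem cleared_eq_mul_of_top_zero (c : ℕ → ℝ) (p : ℕ) (hc : c p = 0) (t : ℝ) :
    ∑ k ∈ range (p + 1), c k * (t ^ k * (1 - t) ^ (p - k)) =
      (1 - t) * ∑ k ∈ range p, c k * (t ^ k * (1 - t) ^ (p - 1 - k)) := by
  rw [Finset.sum_range_succ, hc, zero_mul, add_zero, Finset.mul_sum]
  refine Finset.sum_congr rfl fun k hk => ?_
  have hkp : k < p := mem_range.mp hk
  obtain ⟨j, hj⟩ : ∃ j, p - k = j + 1 := ⟨p - k - 1, by omega⟩
  rw [hj, show p - 1 - k = j by omega, pow_succ]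
  ring

/-- **Even degree, the Laurent representation.**  For `Y` harmonic homogeneous of degree
`n = 2n' ≥ 1` and `p = n' + m`, numerator and denominator of the anisotropy ratio are, on `0 ≤ t < 1`,
`(∑_{k≤p} αₖ tᵏ(1-t)^{p-k})/(1-t)^{p+1}` and `(∑_{k≤p} βₖ tᵏ(1-t)^{p-k})/(1-t)^{p+1}` with
`α_p = 0 < β_p` — the top lattice moment of the harmonic weight vanishes, that of `|x|^{2p}` is positive. -/
theorem even_laurent {Y : Poly} {n n' : ℕ} (hY : Y.IsHomogeneous n) (hn : 1 ≤ n) (hn' : n = n' + n')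
    (hΔ : (∑ i : Fin 3, pderiv i (pderiv i Y)) = 0) (m : ℕ) :
    ∃ α β : ℕ → ℝ, α (n' + m) = 0 ∧ 0 < β (n' + m) ∧ ∀ t : ℝ, 0 ≤ t → t < 1 →
      (∑' x : Site 3, eval (fun i => (x i : ℝ)) Y * Real.sqrt (∑ i, ((x i : ℝ)) ^ 2) ^ (2 * m) *
          srwGreen 3 t x =
        (∑ k ∈ range (n' + m + 1), α k * (t ^ k * (1 - t) ^ (n' + m - k))) / (1 - t) ^ (n' + m + 1)) ∧
      (∑' x : Site 3, Real.sqrt (∑ i, ((x i : ℝ)) ^ 2) ^ (n + 2 * m) * srwGreen 3 t x =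
        (∑ k ∈ range (n' + m + 1), β k * (t ^ k * (1 - t) ^ (n' + m - k))) / (1 - t) ^ (n' + m + 1)) := by
  set p := n' + m with hp
  have h2p : n + 2 * m = 2 * p := by omega
  have hlap : lap Y = 0 := by rw [lap_apply]; exact hΔ
  -- numerator and denominator weights as polynomial evaluations
  have hnumw : ∀ (t : ℝ) (x : Site 3), eval (fun i => (x i : ℝ)) Y *
      Real.sqrt (∑ i, ((x i : ℝ)) ^ 2) ^ (2 * m) * srwGreen 3 t x =
      eval (siteW x) (rsq ^ m * Y) * srwGreen 3 t x := by
    intro t x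
    rw [coe_eq_siteW, sqrt_pow_two_mul_eq_eval, map_mul]; ring
  have hdenw : ∀ (t : ℝ) (x : Site 3), Real.sqrt (∑ i, ((x i : ℝ)) ^ 2) ^ (n + 2 * m) *
      srwGreen 3 t x = eval (siteW x) (rsq ^ p) * srwGreen 3 t x := by
    intro t x
    rw [h2p, sqrt_pow_two_mul_eq_eval]
  -- vanishing beyond the top order, and the top coefficients
  have hKnum : dlap^[p + 1] (rsq ^ m * Y) = 0 := dlap_iterate_rsq_pow_mul_eq_zero hY m (by omega)
  have hKden : dlap^[p + 1] (rsq ^ p) = 0 := dlap_iterate_rsq_pow_eq_zero (Nat.lt_succ_self p)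
  have htopnum : eval 0 (dlap^[p] (rsq ^ m * Y)) = 0 :=
    eval_zero_dlap_iterate_rsq_pow_mul_eq_zero hY hn hlap m (by omega)
  obtain ⟨γ, hγ, hγeq⟩ := dlap_iterate_rsq_pow_self p
  have htopden : eval 0 (dlap^[p] (rsq ^ p)) = γ := by
    rw [hγeq, smul_eval, map_one, mul_one]
  refine ⟨fun k => (6 : ℝ)⁻¹ ^ k * eval 0 (dlap^[k] (rsq ^ m * Y)),
    fun k => (6 : ℝ)⁻¹ ^ k * eval 0 (dlap^[k] (rsq ^ p)), ?_, ?_, fun t ht0 ht1 => ⟨?_, ?_⟩⟩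
  · simp only [htopnum, mul_zero]
  · show 0 < (6 : ℝ)⁻¹ ^ p * eval 0 (dlap^[p] (rsq ^ p))
    rw [htopden]; positivity
  · rw [tsum_congr (hnumw t), tsum_eval_mul_srwGreen _ hKnum ht0 ht1, ← laurent_sum_eq_div _ p ht1]
  · rw [tsum_congr (hdenw t), tsum_eval_mul_srwGreen _ hKden ht0 ht1, ← laurent_sum_eq_div _ p ht1]

/-! ## The Gaussian rung of the milestone -/

/-- **Harmonic dilution on the Gaussian rung** (CampostriniEtAl1998 §4.2, `ρ = 2` for the lattice
Gaussian model, in the no-rate form of item `HarmonicDilution`).  For the simple-random-walk Green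
function `C_t = srwGreen 3 t` on `ℤ³` in place of the Ising two-point function, every anisotropy
ratio `a_{Y,m}(t) = ∑ₓ Y(x)|x|^{2m}C_t(x) / ∑ₓ |x|^{n+2m}C_t(x)`, `Y` harmonic homogeneous of degree
`n ≥ 1`, tends to `0` as `t ↑ 1` (the massless limit).  The statement is, symbol for symbol, the
route decl `HarmonicDilution` with `twoPointFree 3` replaced by `srwGreen 3` and `β_c(3)` by `1`. -/
theorem srwGreen_harmonicDilution :
    let G : ℝ → Site 3 → ℝ := fun t x => srwGreen 3 t x
    let nE : Site 3 → ℝ := fun x : Site 3 => Real.sqrt (∑ i, ((x i : ℝ)) ^ 2)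
    let k : MvPolynomial (Fin 3) ℝ → ℕ → ℝ → ℝ := fun Y m t =>
      ∑' x : Site 3, MvPolynomial.eval (fun i => (x i : ℝ)) Y * nE x ^ (2 * m) * G t x
    let M : ℕ → ℝ → ℝ := fun q t => ∑' x : Site 3, nE x ^ q * G t x
    let a : MvPolynomial (Fin 3) ℝ → ℕ → ℕ → ℝ → ℝ := fun Y n m t => k Y m t / M (n + 2 * m) t
    ∀ (n m : ℕ) (Y : MvPolynomial (Fin 3) ℝ), 1 ≤ n → Y.IsHomogeneous n →
      (∑ i : Fin 3, MvPolynomial.pderiv i (MvPolynomial.pderiv i Y)) = 0 →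
        Filter.Tendsto (fun t => a Y n m t) (nhdsWithin 1 (Set.Iio 1)) (nhds 0) := by
  dsimp only
  intro n m Y hn hY hΔ
  rcases Nat.even_or_odd n with ⟨n', hn'⟩ | hodd
  · -- even degree `n = 2n'`: quotient of the cleared Laurent sums, continuous at `t = 1`
    obtain ⟨α, β, hαp, hβp, hrep⟩ := even_laurent hY hn hn' hΔ m
    set p := n' + m with hp
    have hlim : Tendsto (fun t : ℝ => (∑ k ∈ range (p + 1), α k * (t ^ k * (1 - t) ^ (p - k))) /
        ∑ k ∈ range (p + 1), β k * (t ^ k * (1 - t) ^ (p - k))) (𝓝 1) (𝓝 0) := by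
      have h := ((continuous_cleared α p).tendsto 1).div ((continuous_cleared β p).tendsto 1)
        (by rw [cleared_one]; exact hβp.ne')
      rw [cleared_one, cleared_one, hαp, zero_div] at h
      exact h
    refine (tendsto_nhdsWithin_of_tendsto_nhds hlim).congr' ?_
    filter_upwards [Ioo_mem_nhdsLT (zero_lt_one' ℝ)] with t ht
    rw [Set.mem_Ioo] at ht
    obtain ⟨hnum, hden⟩ := hrep t ht.1.le ht.2
    rw [hnum, hden, div_div_div_cancel_right₀ (pow_ne_zero _ (sub_pos.2 ht.2).ne')]
  · -- odd degree: the numerator is identically zero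
    have h0 : ∀ t : ℝ, ∑' x : Site 3, eval (fun i => (x i : ℝ)) Y *
        Real.sqrt (∑ i, ((x i : ℝ)) ^ 2) ^ (2 * m) * srwGreen 3 t x = 0 :=
      fun t => tsum_odd_eq_zero hY hodd m t
    simp only [h0, zero_div]
    exact tendsto_const_nhds

/-- **The rate is `ρ = 2`** (CampostriniEtAl1998 §4.2: "for `N = ∞`, `ρ = 2`").  On the Gaussian rung
every anisotropy ratio is `O(1 - t)`, i.e. `O(m²) = O(ξ⁻²)` in the mass `m² = 6(1-t)/t`: the limit
`lim_{t↑1} a_{Y,m}(t)/(1-t)` exists (it is the ratio of the next-to-top lattice moment of the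
harmonic weight to the top moment of `|x|^{n+2m}`; e.g. for `Y = K₄ = ∑xᵢ⁴ - (3/5)|x|⁴`, `m = 0`:
`(N K₄)(0) = 12/5`, `(N|x|⁴)(0) = 6`, `(N²|x|⁴)(0) = 120`, so `a_{K₄,0}(t) = (2/5)(1-t)/(1+(7/3)t)`
and the limit is `3/25`). -/
theorem srwGreen_harmonicDilution_rate :
    let G : ℝ → Site 3 → ℝ := fun t x => srwGreen 3 t x
    let nE : Site 3 → ℝ := fun x : Site 3 => Real.sqrt (∑ i, ((x i : ℝ)) ^ 2)
    let k : MvPolynomial (Fin 3) ℝ → ℕ → ℝ → ℝ := fun Y m t =>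
      ∑' x : Site 3, MvPolynomial.eval (fun i => (x i : ℝ)) Y * nE x ^ (2 * m) * G t x
    let M : ℕ → ℝ → ℝ := fun q t => ∑' x : Site 3, nE x ^ q * G t x
    let a : MvPolynomial (Fin 3) ℝ → ℕ → ℕ → ℝ → ℝ := fun Y n m t => k Y m t / M (n + 2 * m) t
    ∀ (n m : ℕ) (Y : MvPolynomial (Fin 3) ℝ), 1 ≤ n → Y.IsHomogeneous n →
      (∑ i : Fin 3, MvPolynomial.pderiv i (MvPolynomial.pderiv i Y)) = 0 →
        ∃ L : ℝ, Filter.Tendsto (fun t => a Y n m t / (1 - t)) (nhdsWithin 1 (Set.Iio 1)) (nhds L) := by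
  dsimp only
  intro n m Y hn hY hΔ
  rcases Nat.even_or_odd n with ⟨n', hn'⟩ | hodd
  · obtain ⟨α, β, hαp, hβp, hrep⟩ := even_laurent hY hn hn' hΔ m
    set p := n' + m with hp
    -- after cancelling one factor `1 - t` the ratio is again a quotient of polynomials
    set Nr : ℝ → ℝ := fun t => ∑ k ∈ range p, α k * (t ^ k * (1 - t) ^ (p - 1 - k)) with hNr
    set Dc : ℝ → ℝ := fun t => ∑ k ∈ range (p + 1), β k * (t ^ k * (1 - t) ^ (p - k)) with hDc
    have hNr_cont : Continuous Nr := continuous_finsetSum _ fun k _ => by fun_prop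
    have hDc1 : Dc 1 ≠ 0 := by simp only [hDc, cleared_one]; exact hβp.ne'
    refine ⟨Nr 1 / Dc 1, ?_⟩
    have hlim : Tendsto (fun t => Nr t / Dc t) (𝓝 1) (𝓝 (Nr 1 / Dc 1)) :=
      (hNr_cont.tendsto 1).div ((continuous_cleared β p).tendsto 1) hDc1
    refine (tendsto_nhdsWithin_of_tendsto_nhds hlim).congr' ?_
    filter_upwards [Ioo_mem_nhdsLT (zero_lt_one' ℝ)] with t ht
    rw [Set.mem_Ioo] at ht
    have h1t : (1 - t) ≠ 0 := (sub_pos.2 ht.2).ne'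
    obtain ⟨hnum, hden⟩ := hrep t ht.1.le ht.2
    rw [hnum, hden, div_div_div_cancel_right₀ (pow_ne_zero _ h1t), cleared_eq_mul_of_top_zero α p hαp]
    show Nr t / Dc t = (1 - t) * Nr t / Dc t / (1 - t)
    field_simp
  · refine ⟨0, ?_⟩
    have h0 : ∀ t : ℝ, ∑' x : Site 3, eval (fun i => (x i : ℝ)) Y *
        Real.sqrt (∑ i, ((x i : ℝ)) ^ 2) ^ (2 * m) * srwGreen 3 t x = 0 :=
      fun t => tsum_odd_eq_zero hY hodd m t
    simp only [h0, zero_div]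
    exact tendsto_const_nhds

end Summit.CriticalPhenomena.Ising3DConformalLimit.Theorems.HarmonicMomentsIsotropy.GaussianRung
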